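import Mathlib.NumberTheory.Real.Irrational
import Mathlib.Analysis.Real.Sqrt
import Mathlib.Algebra.Order.Floor.Ring
import Mathlib.Tactic.Linarith
import Mathlib.Tactic.LinearCombination
import Mathlib.Tactic.FieldSimp
import Mathlib.Tactic.Ring
import HarnessLib

/-!
# The two-sided lattice `ℤ + ℤψ` of a reduced quadratic irrational: `1` and `ψ` are adjacent minima

Topic `NumberTheory/QuadraticFields` (the infrastructure of a real quadratic order, II; sequel in spirit
to `ReducedQuadraticIrrationals.lean`). For real numbers `ψ > 1` and `-1 < ψ' < 0` consider the plane
lattice `Λ = {(x + yψ, x + yψ') : x, y ∈ ℤ}` — the image under the two real embeddings of the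
`ℤ`-module `ℤ + ℤψ` when `ψ = (b + √Δ)/2a` is a reduced quadratic irrational and `ψ'` its conjugate
(Jacobson–Williams, *Solving the Pell Equation*, §3.3 (3.36): reduced means `ψ > 1`, `-1 < ψ̄ < 0`).
A lattice point is a *minimum* when no nonzero lattice point is smaller in BOTH coordinates
(op. cit. §5.1, definition of a reduced ideal / Theorem 5.8). This file proves, by elementary case
analysis on the sign of `y`, the four facts about `Λ` on which the whole infrastructure rests:

* `one_isMin` — `1 = (1, 1)` is a minimum of `Λ` (op. cit. Thm. 5.8, "`𝔞 = [a, β]`, `β > a`,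
  `-a < β̄ < 0` ⟹ `𝔞` reduced");
* `psi_isMin` — `ψ = (ψ, ψ')` is a minimum of `Λ`;
* `psi_le_of_one_lt` — a lattice point with `|x + yψ'| < 1 < |x + yψ|` has `|x + yψ| ≥ ψ`: the minimum
  adjacent to `1` is `ψ` (op. cit. §5.3, Thm. 5.18: the reduced ideals equivalent to `𝔞` are exactly the
  `ρⁿ(𝔞)`), i.e. the reduction step `ρ` moves to the NEXT minimum and skips none;
* `two_lt_of_psi_lt` — a lattice point with `|x + yψ'| < |ψ'|` and `|x + yψ| > ψ` has `|x + yψ| > 2`: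
  two reduction steps more than double the distance (op. cit. §5.3, proof of Thm. 5.18:
  "`φ_{k+1} φ_k > 2`"; §3.2 (3.17) with Prop. 3.16).

Everything is proved; no named facts. The transport of these statements to the order `𝒪_Δ` and its
reduced ideals is in `InfrastructureMinima.lean`.

## References

* M. J. Jacobson, Jr., H. C. Williams, *Solving the Pell Equation*, CMS Books in Mathematics, Springer
  (2009), §3.3 (3.36), §5.1 Thm. 5.8, Cor. 5.8.1, §5.3 Thm. 5.18. [JacobsonWilliams2008]
-/

namespace Literature.NumberTheory.QuadraticFields.Infra

/-- Auxiliary: an integer that is `< 1` as a real number is `≤ 0`. [folklore] -/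
theorem int_le_zero_of_lt_one {x : ℤ} (h : (x : ℝ) < 1) : x ≤ 0 := by
  have : x < 1 := by exact_mod_cast h
  omega

/-- Auxiliary: an integer that is `> -1` as a real number is `≥ 0`. [folklore] -/
theorem int_nonneg_of_neg_one_lt {x : ℤ} (h : (-1 : ℝ) < x) : 0 ≤ x := by
  have : -1 < x := by exact_mod_cast h
  omega

/-- Auxiliary: an integer that is `> 0` as a real number is `≥ 1`. [folklore] -/
theorem int_one_le_of_pos {x : ℤ} (h : (0 : ℝ) < x) : 1 ≤ x := by
  have : 0 < x := by exact_mod_cast h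
  omega

/-- Auxiliary: an integer that is `< 0` as a real number is `≤ -1`. [folklore] -/
theorem int_le_neg_one_of_neg {x : ℤ} (h : (x : ℝ) < 0) : x ≤ -1 := by
  have : x < 0 := by exact_mod_cast h
  omega

variable {ψ ψ' : ℝ}

/-- **`1` is a minimum of `ℤ + ℤψ`**: a nonzero lattice point `x + yψ` with `|x + yψ| < 1` has conjugate
`|x + yψ'| ≥ 1` (Jacobson–Williams Thm. 5.8, sufficiency: with `β = aψ`, "`xy < 0` by the first
inequality and `xy > 0` by the second"). [cite: JacobsonWilliams2008, §5.1 Thm. 5.8] -/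
theorem one_isMin (h1 : 1 < ψ) (h2 : -1 < ψ') (h3 : ψ' < 0) {x y : ℤ} (hne : (x, y) ≠ (0, 0))
    (hlt : |(x : ℝ) + y * ψ| < 1) : 1 ≤ |(x : ℝ) + y * ψ'| := by
  rw [abs_lt] at hlt
  obtain ⟨hlo, hhi⟩ := hlt
  rcases lt_trichotomy y 0 with hy | hy | hy
  · -- `y ≤ -1`: then `x ≥ 1` and `x + yψ' ≥ 1`
    have hy' : (y : ℝ) ≤ -1 := by exact_mod_cast (show y ≤ -1 by omega)
    have hyψ : (y : ℝ) * ψ ≤ -ψ := by nlinarith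
    have hx : (0 : ℝ) < x := by linarith
    have hx1 : (1 : ℝ) ≤ x := by exact_mod_cast int_one_le_of_pos hx
    have hyψ' : (0 : ℝ) < y * ψ' := by nlinarith
    rw [le_abs]
    left
    linarith
  · -- `y = 0`: then `|x| < 1`, so `x = 0`, contradiction
    subst hy
    simp only [Int.cast_zero, zero_mul, add_zero] at hlo hhi
    have hx0 : x = 0 := by
      have h0 : x ≤ 0 := int_le_zero_of_lt_one hhi
      have h0' : 0 ≤ x := int_nonneg_of_neg_one_lt hlo
      omega
    exact absurd (by rw [hx0]) hne
  · -- `y ≥ 1`: then `x ≤ -1` and `x + yψ' ≤ -1 + yψ' < -1`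
    have hy' : (1 : ℝ) ≤ y := by exact_mod_cast (show 1 ≤ y by omega)
    have hyψ : ψ ≤ (y : ℝ) * ψ := by nlinarith
    have hx : (x : ℝ) < 0 := by linarith
    have hx1 : (x : ℝ) ≤ -1 := by exact_mod_cast int_le_neg_one_of_neg hx
    have hyψ' : (y : ℝ) * ψ' < 0 := by nlinarith
    rw [le_abs]
    right
    linarith

/-- **`ψ` is a minimum of `ℤ + ℤψ`**: a nonzero lattice point with `|x + yψ| < ψ` has
`|x + yψ'| ≥ |ψ'|`. [cite: JacobsonWilliams2008, §5.1 Thm. 5.8 and §5.3 (5.17)] -/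
theorem psi_isMin (h1 : 1 < ψ) (h2 : -1 < ψ') (h3 : ψ' < 0) {x y : ℤ} (hne : (x, y) ≠ (0, 0))
    (hlt : |(x : ℝ) + y * ψ| < ψ) : |ψ'| ≤ |(x : ℝ) + y * ψ'| := by
  rw [abs_lt] at hlt
  obtain ⟨hlo, hhi⟩ := hlt
  rw [abs_of_neg h3]
  rcases lt_trichotomy y 0 with hy | hy | hy
  · -- `y ≤ -1`: `x > (|y| - 1)ψ ≥ 0`, so `x ≥ 1` and `x + yψ' ≥ 1 > |ψ'|`
    have hy' : (y : ℝ) ≤ -1 := by exact_mod_cast (show y ≤ -1 by omega)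
    have hyψ : (y : ℝ) * ψ + ψ ≤ 0 := by nlinarith
    have hx : (0 : ℝ) < x := by linarith
    have hx1 : (1 : ℝ) ≤ x := by exact_mod_cast int_one_le_of_pos hx
    have hyψ' : (0 : ℝ) < y * ψ' := by nlinarith
    rw [le_abs]
    left
    linarith
  · subst hy
    simp only [Int.cast_zero, zero_mul, add_zero] at hlo hhi ⊢
    have hx0 : x ≠ 0 := fun h => hne (by rw [h])
    have : (1 : ℝ) ≤ |(x : ℝ)| := by
      rw [← Int.cast_abs]
      exact_mod_cast Int.one_le_abs hx0
    linarith
  · -- `y ≥ 1`: `x < (1 - y)ψ ≤ 0`, so `x ≤ -1` and `x + yψ' ≤ -1 + ψ' `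
    have hy' : (1 : ℝ) ≤ y := by exact_mod_cast (show 1 ≤ y by omega)
    have hyψ : ψ ≤ (y : ℝ) * ψ := by nlinarith
    have hx : (x : ℝ) < 0 := by linarith
    have hx1 : (x : ℝ) ≤ -1 := by exact_mod_cast int_le_neg_one_of_neg hx
    have hyψ' : (y : ℝ) * ψ' ≤ ψ' := by nlinarith
    rw [le_abs]
    right
    linarith

/-- **The minimum adjacent to `1` is `ψ`**: a lattice point with `|x + yψ'| < 1` and `|x + yψ| > 1`
satisfies `|x + yψ| ≥ ψ` — so the walk by reduction steps visits every minimum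
(Jacobson–Williams Thm. 5.18). [cite: JacobsonWilliams2008, §5.3 Thm. 5.18] -/
theorem psi_le_of_one_lt (h1 : 1 < ψ) (h2 : -1 < ψ') (h3 : ψ' < 0) {x y : ℤ}
    (hc : |(x : ℝ) + y * ψ'| < 1) (hv : 1 < |(x : ℝ) + y * ψ|) : ψ ≤ |(x : ℝ) + y * ψ| := by
  rw [abs_lt] at hc
  obtain ⟨hclo, hchi⟩ := hc
  rcases lt_trichotomy y 0 with hy | hy | hy
  · -- `y ≤ -1`: `-|y| ≤ x ≤ 0`, so `x + yψ ≤ yψ ≤ -ψ`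
    have hy' : (y : ℝ) ≤ -1 := by exact_mod_cast (show y ≤ -1 by omega)
    have hyψ' : (0 : ℝ) < y * ψ' := by nlinarith
    have hx : (x : ℝ) < 1 := by linarith
    have hx0 : (x : ℝ) ≤ 0 := by exact_mod_cast int_le_zero_of_lt_one hx
    have hyψ : (y : ℝ) * ψ ≤ -ψ := by nlinarith
    rw [le_abs]
    right
    linarith
  · subst hy
    simp only [Int.cast_zero, zero_mul, add_zero] at hclo hchi hv
    exfalso
    have := lt_abs.mp hv
    rcases this with h | h <;> linarith
  · -- `y ≥ 1`: `0 ≤ x`, so `x + yψ ≥ yψ ≥ ψ`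
    have hy' : (1 : ℝ) ≤ y := by exact_mod_cast (show 1 ≤ y by omega)
    have hyψ' : (y : ℝ) * ψ' < 0 := by nlinarith
    have hx : (-1 : ℝ) < x := by linarith
    have hx0 : (0 : ℝ) ≤ x := by exact_mod_cast int_nonneg_of_neg_one_lt hx
    have hyψ : ψ ≤ (y : ℝ) * ψ := by nlinarith
    rw [le_abs]
    left
    linarith

/-- **Two steps more than double**: a lattice point with `|x + yψ'| < |ψ'|` and `|x + yψ| > ψ` has
`|x + yψ| > 2` (Jacobson–Williams, proof of Thm. 5.18: `φ_{k+1} φ_k > 2`).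
[cite: JacobsonWilliams2008, §5.3 Thm. 5.18 (proof)] -/
theorem two_lt_of_psi_lt (h1 : 1 < ψ) (h2 : -1 < ψ') (h3 : ψ' < 0) {x y : ℤ}
    (hc : |(x : ℝ) + y * ψ'| < |ψ'|) (hv : ψ < |(x : ℝ) + y * ψ|) : 2 < |(x : ℝ) + y * ψ| := by
  rw [abs_of_neg h3, abs_lt] at hc
  obtain ⟨hclo, hchi⟩ := hc
  rcases lt_trichotomy y 0 with hy | hy | hy
  · -- `y ≤ -1`: `x < |ψ'|(1 - |y|) ≤ 0`, so `x ≤ -1` and `x + yψ ≤ -1 - ψ < -2`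
    have hy' : (y : ℝ) ≤ -1 := by exact_mod_cast (show y ≤ -1 by omega)
    have hyψ' : -ψ' ≤ (y : ℝ) * ψ' := by nlinarith
    have hx : (x : ℝ) < 0 := by linarith
    have hx1 : (x : ℝ) ≤ -1 := by exact_mod_cast int_le_neg_one_of_neg hx
    have hyψ : (y : ℝ) * ψ ≤ -ψ := by nlinarith
    rw [lt_abs]
    right
    linarith
  · subst hy
    simp only [Int.cast_zero, zero_mul, add_zero] at hclo hchi hv
    exfalso
    have hx0 : x = 0 := by
      have h0 : (x : ℝ) < 1 := by linarith
      have h0' : (-1 : ℝ) < x := by linarith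
      have := int_le_zero_of_lt_one h0
      have := int_nonneg_of_neg_one_lt h0'
      omega
    subst hx0
    simp at hv
    linarith
  · -- `y ≥ 1`: `x > (y - 1)|ψ'| ≥ 0`, so `x ≥ 1` and `x + yψ ≥ 1 + ψ > 2`
    have hy' : (1 : ℝ) ≤ y := by exact_mod_cast (show 1 ≤ y by omega)
    have hyψ' : (y : ℝ) * ψ' ≤ ψ' := by nlinarith
    have hx : (0 : ℝ) < x := by linarith
    have hx1 : (1 : ℝ) ≤ x := by exact_mod_cast int_one_le_of_pos hx
    have hyψ : ψ ≤ (y : ℝ) * ψ := by nlinarith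
    rw [lt_abs]
    left
    linarith

/-- **Reducedness from minimality**: if no nonzero lattice point of `ℤ + ℤψ` has `|x + yψ| < 1` and
`|x + yψ'| < 1` (i.e. `1` is a minimum), `-1 < ψ' < 0` and `ψ ≠ 1`, then `ψ > 1`
(Jacobson–Williams Thm. 5.10: the normalised `β` of a reduced ideal exceeds `a`).
[cite: JacobsonWilliams2008, §5.1 Thm. 5.10] -/
theorem one_lt_psi_of_isMin (h2 : -1 < ψ') (h3 : ψ' < 0) (hgap : ψ' < ψ) (hne : ψ ≠ 1)
    (hmin : ∀ x y : ℤ, (x, y) ≠ (0, 0) → |(x : ℝ) + y * ψ| < 1 → 1 ≤ |(x : ℝ) + y * ψ'|) : 1 < ψ := by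
  by_contra hle
  push Not at hle
  have hlt : ψ < 1 := lt_of_le_of_ne hle hne
  have h := hmin 0 1 (by simp) (by
    simp only [Int.cast_zero, Int.cast_one, one_mul, zero_add]
    rw [abs_lt]; constructor <;> linarith)
  simp only [Int.cast_zero, Int.cast_one, one_mul, zero_add] at h
  rw [abs_of_neg h3] at h
  linarith

end Literature.NumberTheory.QuadraticFields.Infra
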